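import Literature.MathematicalPhysics.QuantumFieldTheory.Balaban1983to89.B9Thm311ReadingAtLettersQ

/-!
# `Balaban1983to89.B9Thm311ReadingAtLettersQJ` — T. Bałaban, *Propagators for lattice gauge theories in a background field*, Commun. Math. Phys. **99** (1985)
# 389–434 [Balaban1985BackgroundPropagators], THEOREM 3.11 p. 416: ROW 17's K2 READING `B9Thm311ReadingAtLettersQ.t311_of_pins_opsYOfLettersRQ` ALONG A
# SUB-FAMILY `f : J → MemberY` (the «J-twin» of one producer of the N06 knit cone — dag-n06-d g30's BY-NAME ASK №6 under director-ym №524 (3), IR-N06-SECTION-2 road R1)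

statement-level skeleton of published theorems with citation tags; proofs where landed; nothing here is a claim about the Yang–Mills mass gap

THE PRINT.  Thm 3.11 p. 416 («the operators Δ′_a, G′, (Q′G′²Q′\*)⁻¹, Δ_a, G are positive definite … for M ≧ M₃, α₀M ≦ a₀»); (3.24)–(3.27) pp. 394–395;
(3.35) p. 396.  The printed statement quantifies over a FAMILY of lattice data; the tree's `B9.Thm311Printed {I : Type} c geo bg PosDef` (`B9.lean`) is generic in the
index type `I`, so the same printed sentence is read over any sub-family `j ↦ f j`.

WHY THIS FILE (cell `pub-ymgap`, node N06, seat `dag-n06-j` gen 38 = bundle F5 row 17).  The N06 knit certificate's leaf is indexed by a section-carrying sub-family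
`J` (`B9LeafXCodedKnitUParHX.carriersYUParHX_I9 = J`); road R1 of IR-N06-SECTION-2 re-indexes every producer of the cone whose displayed rows are fed by rows 15∕16∕17
(`h348`, `hΔAK`) along `f : J → MemberY`, so that those rows are displayed AT `f j` only.  The parent `t311_of_pins_opsYOfLettersRQ` concludes
`B9.Thm311Printed c geo9Y (bg9YR … R₁ R₂) (fun x => (opsYOfLetters … x).PosDef)` over ALL members from the schema row `h311 : ∀ x, …`; its consumer «KCXS» feeds `h311` pointwise
from `hΔAK`.  THIS FILE is the along-`f` edition: the tainted row `h311` quantifies over `j : J` at `f j`, the letters ∕ averaging family ∕ pins stay member-wide (read at `f j`),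
the conclusion is `B9.Thm311Printed c (fun j => geo9Y (f j)) (fun j => bg9YR … (f j)) (fun j => (opsYOfLetters … (f j)).PosDef)` — the shape `B9LeafXCodedKnitU.thm311Printed_reindex f`
produces and «KCXS»ᴶ consumes.

WHAT IS PROVED (sorry-free; the parent's eight-line proof verbatim with `x ↦ f j`).
* ★★ `t311_of_pins_opsYOfLettersRQ_J` — as above; printed quantifiers met with `M₃ := max M₁ 2θ₁`, `a₀ := a₁` (as the parent).
* `t311_of_pins_opsYOfLettersRQ_J_val` — the instance `J := {x // p x}`, `f := Subtype.val` (e.g. `SCMemberY`), for consumers keying the sub-family as a subtype.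
HONEST SCOPE.  Re-indexing only; no estimate of [B9] asserted or re-proved; the schema `Inputs311YQ` (this lineage's displayed L²-smallness reading, GAPS G-B9-06) stays the
hypothesis; helper, count-neutral; N06 NOT discharged; nothing continuum ∕ OS ∕ mass gap ∕ Clay — the Yang–Mills mass gap is NOT proved here.  No `sorry`, no `axiom`, no
`instance`, no `notation`, no `def`.  NEW file; the parent is untouched.
RELATED, NOT DUPLICATED (searched 2026-08-31: `ls Literature/…/Balaban1983to89 | grep -i ReadingAtLettersQJ` = ∅; `rg -l -w t311_of_pins_opsYOfLettersRQ_J` = ∅): parent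
`B9Thm311ReadingAtLettersQ` (USED); dag-n06-d's R1 siblings `…ParJ` ∕ `B9LeafXCodedKnitUParHXJ` (same re-indexing rule (R)).
-/

noncomputable section

namespace Literature.MathematicalPhysics.QuantumFieldTheory.Balaban1983to89.B9Thm311ReadingAtLettersQJ

open Literature.MathematicalPhysics.QuantumFieldTheory.Balaban1983to89
open B9Thm311Whole B9Thm311ReadingCoords B9Thm311ReadingAtLetters B9Thm311PosAtRecordV4 Node00
open B6KLevelCensusIndexV1 B9PinMembersKLevelV1 B9PinCarriersKLevelV1 B9PinGeometryKLevelV1 B7Prop2SpecialUnitary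
open B9BackgroundsKLevelV1R
open B9Thm311ReadingAtLettersQ
open scoped InnerProductSpace Matrix.Norms.L2Operator

variable {N : ℕ} (θ : Stage3Params) (Mstar : ℕ) (𝔏 : LettersY N θ Mstar) (𝔈 : ExpsY N θ Mstar)
variable (R₁ R₂ : RegFamY θ.d₆ θ.ℓ₆ θ.hd' θ.hL' θ.b₀ θ.b₁ Mstar (Matrix (Fin N) (Fin N) ℂ))

/-- ★★ **ROW 17 OF THE N06 KNIT AT `opsYOfLetters N θ M⋆ 𝔏 𝔈` ALONG A SUB-FAMILY `f : J → MemberY`** (the parent `t311_of_pins_opsYOfLettersRQ` with its schema row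
`h311` read at `f j` only; letters `𝔏`, averaging family `(𝔮, 𝔮s)`, transporters `parA`, proof letters `𝔔` and the pins `hGp hGA hPD` member-wide):
`B9.Thm311Printed c (fun j => geo9Y (f j)) (fun j => bg9YR … R₁ R₂ (f j)) (fun j => (opsYOfLetters … (f j)).PosDef)`; printed quantifiers met with `M₃ := max M₁ 2θ₁`, `a₀ := a₁`.
[cite: Balaban1985BackgroundPropagators, Thm 3.11 p.416 + (3.24)–(3.27) pp.394–395 + (3.35) p.396; Balaban1984PropagatorsI, p.25] -/
theorem t311_of_pins_opsYOfLettersRQ_J {J : Type} (f : J → MemberY θ.d₆ θ.ℓ₆ θ.hd' θ.hL' θ.b₀ θ.b₁ Mstar)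
    (parA : ∀ x : MemberY θ.d₆ θ.ℓ₆ θ.hd' θ.hL' θ.b₀ θ.b₁ Mstar, SiteParY (Matrix (Fin N) (Fin N) ℂ) x.toKIdx)
    (𝔮 : ∀ x : MemberY θ.d₆ θ.ℓ₆ θ.hd' θ.hL' θ.b₀ θ.b₁ Mstar, CfgY (Matrix (Fin N) (Fin N) ℂ) x.toKIdx →
      ((FBondY x.toKIdx → Matrix (Fin N) (Fin N) ℂ) →ₗ[ℂ] (IBondY x.toKIdx → Matrix (Fin N) (Fin N) ℂ)))
    (𝔮s : ∀ x : MemberY θ.d₆ θ.ℓ₆ θ.hd' θ.hL' θ.b₀ θ.b₁ Mstar, CfgY (Matrix (Fin N) (Fin N) ℂ) x.toKIdx →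
      ((IBondY x.toKIdx → Matrix (Fin N) (Fin N) ℂ) →ₗ[ℂ] (FBondY x.toKIdx → Matrix (Fin N) (Fin N) ℂ)))
    (𝔔 : ∀ x : MemberY θ.d₆ θ.ℓ₆ θ.hd' θ.hL' θ.b₀ θ.b₁ Mstar, ProofLetters311 N x.toKIdx)
    (c θ₁ a₁ M₁ : ℝ) (ha₁ : 0 < a₁) (hM₁ : 0 < M₁)
    (hGp : ∀ x : MemberY θ.d₆ θ.ℓ₆ θ.hd' θ.hL' θ.b₀ θ.b₁ Mstar, (𝔏 x).Gp = GpY x.toKIdx (parA x))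
    (hGA : ∀ x : MemberY θ.d₆ θ.ℓ₆ θ.hd' θ.hL' θ.b₀ θ.b₁ Mstar, (𝔏 x).GA = GAQY x.toKIdx (𝔮 x) (𝔮s x) (parA x) (𝔏 x).Gp)
    (h311 : ∀ j : J, M₁ ≤ (geo9Y (f j)).M → ∀ α₀ : ℝ, 0 < α₀ → (geo9Y (f j)).M * α₀ ≤ a₁ →
      ∀ U : (bg9YR (Matrix (Fin N) (Fin N) ℂ) (specialUnitaryUnits (Fin N)) R₁ R₂ (f j)).Cfg,
        (bg9YR (Matrix (Fin N) (Fin N) ℂ) (specialUnitaryUnits (Fin N)) R₁ R₂ (f j)).Reg335 c α₀ U →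
          Inputs311YQ (f j) (𝔏 (f j)) (parA (f j)) (𝔮 (f j)) (𝔮s (f j)) (𝔔 (f j)) θ₁ (geo9Y (f j)).M U)
    (hPD : ∀ x : MemberY θ.d₆ θ.ℓ₆ θ.hd' θ.hL' θ.b₀ θ.b₁ Mstar,
      ((opsYOfLetters N θ Mstar 𝔏 𝔈) x).PosDef = PosDefOfOps (ops311YQ x (𝔏 x) (parA x) (𝔮 x) (𝔮s x) (𝔔 x))) :
    B9.Thm311Printed c (fun j => geo9Y (f j)) (fun j => bg9YR (Matrix (Fin N) (Fin N) ℂ) (specialUnitaryUnits (Fin N)) R₁ R₂ (f j))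
      (fun j => ((opsYOfLetters N θ Mstar 𝔏 𝔈) (f j)).PosDef) := by
  refine ⟨max M₁ (2 * θ₁), a₁, lt_max_of_lt_left hM₁, ha₁, fun j hM α₀ hα₀ hMa U hU n => ?_⟩
  have hM₁x : M₁ ≤ (geo9Y (f j)).M := le_trans (le_max_left _ _) hM
  have hMpos : 0 < (geo9Y (f j)).M := lt_of_lt_of_le hM₁ hM₁x
  have hI : Inputs311 (ops311YQ (f j) (𝔏 (f j)) (parA (f j)) (𝔮 (f j)) (𝔮s (f j)) (𝔔 (f j))) θ₁ (geo9Y (f j)).M U :=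
    inputs311Q_ops311YQ (hGp (f j)) (hGA (f j)) (h311 j hM₁x α₀ hα₀ hMa U hU)
  have hgoal : PosDefOfOps (ops311YQ (f j) (𝔏 (f j)) (parA (f j)) (𝔮 (f j)) (𝔮s (f j)) (𝔔 (f j))) n U :=
    posDefOfOps_all _ hMpos (le_trans (le_max_right _ _) hM) hI n
  have hPDx := congrFun (congrFun (hPD (f j)) n) U
  exact Eq.mpr hPDx hgoal

/-- ★ **THE SAME AT A SUBTYPE SUB-FAMILY** `J := {x // p x}`, `f := Subtype.val` (e.g. n06-c's `SCMemberY`-style carriers keyed as subtypes of `MemberY`).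
[cite: Balaban1985BackgroundPropagators, Thm 3.11 p.416 + (3.35) p.396 (bookkeeping: the sub-family)] -/
theorem t311_of_pins_opsYOfLettersRQ_J_val (p : MemberY θ.d₆ θ.ℓ₆ θ.hd' θ.hL' θ.b₀ θ.b₁ Mstar → Prop)
    (parA : ∀ x : MemberY θ.d₆ θ.ℓ₆ θ.hd' θ.hL' θ.b₀ θ.b₁ Mstar, SiteParY (Matrix (Fin N) (Fin N) ℂ) x.toKIdx)
    (𝔮 : ∀ x : MemberY θ.d₆ θ.ℓ₆ θ.hd' θ.hL' θ.b₀ θ.b₁ Mstar, CfgY (Matrix (Fin N) (Fin N) ℂ) x.toKIdx →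
      ((FBondY x.toKIdx → Matrix (Fin N) (Fin N) ℂ) →ₗ[ℂ] (IBondY x.toKIdx → Matrix (Fin N) (Fin N) ℂ)))
    (𝔮s : ∀ x : MemberY θ.d₆ θ.ℓ₆ θ.hd' θ.hL' θ.b₀ θ.b₁ Mstar, CfgY (Matrix (Fin N) (Fin N) ℂ) x.toKIdx →
      ((IBondY x.toKIdx → Matrix (Fin N) (Fin N) ℂ) →ₗ[ℂ] (FBondY x.toKIdx → Matrix (Fin N) (Fin N) ℂ)))
    (𝔔 : ∀ x : MemberY θ.d₆ θ.ℓ₆ θ.hd' θ.hL' θ.b₀ θ.b₁ Mstar, ProofLetters311 N x.toKIdx)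
    (c θ₁ a₁ M₁ : ℝ) (ha₁ : 0 < a₁) (hM₁ : 0 < M₁)
    (hGp : ∀ x : MemberY θ.d₆ θ.ℓ₆ θ.hd' θ.hL' θ.b₀ θ.b₁ Mstar, (𝔏 x).Gp = GpY x.toKIdx (parA x))
    (hGA : ∀ x : MemberY θ.d₆ θ.ℓ₆ θ.hd' θ.hL' θ.b₀ θ.b₁ Mstar, (𝔏 x).GA = GAQY x.toKIdx (𝔮 x) (𝔮s x) (parA x) (𝔏 x).Gp)
    (h311 : ∀ j : {x // p x}, M₁ ≤ (geo9Y j.val).M → ∀ α₀ : ℝ, 0 < α₀ → (geo9Y j.val).M * α₀ ≤ a₁ →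
      ∀ U : (bg9YR (Matrix (Fin N) (Fin N) ℂ) (specialUnitaryUnits (Fin N)) R₁ R₂ j.val).Cfg,
        (bg9YR (Matrix (Fin N) (Fin N) ℂ) (specialUnitaryUnits (Fin N)) R₁ R₂ j.val).Reg335 c α₀ U →
          Inputs311YQ j.val (𝔏 j.val) (parA j.val) (𝔮 j.val) (𝔮s j.val) (𝔔 j.val) θ₁ (geo9Y j.val).M U)
    (hPD : ∀ x : MemberY θ.d₆ θ.ℓ₆ θ.hd' θ.hL' θ.b₀ θ.b₁ Mstar,
      ((opsYOfLetters N θ Mstar 𝔏 𝔈) x).PosDef = PosDefOfOps (ops311YQ x (𝔏 x) (parA x) (𝔮 x) (𝔮s x) (𝔔 x))) :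
    B9.Thm311Printed c (fun j : {x // p x} => geo9Y j.val)
      (fun j => bg9YR (Matrix (Fin N) (Fin N) ℂ) (specialUnitaryUnits (Fin N)) R₁ R₂ j.val)
      (fun j => ((opsYOfLetters N θ Mstar 𝔏 𝔈) j.val).PosDef) :=
  t311_of_pins_opsYOfLettersRQ_J θ Mstar 𝔏 𝔈 R₁ R₂ Subtype.val parA 𝔮 𝔮s 𝔔 c θ₁ a₁ M₁ ha₁ hM₁ hGp hGA h311 hPD

end Literature.MathematicalPhysics.QuantumFieldTheory.Balaban1983to89.B9Thm311ReadingAtLettersQJ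

end
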